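import Literature.NumberTheory.EllipticCurves.IwasawaAlgebraEisensteinQuotientDuality
import HarnessLib

/-!
# Frobenius reciprocity for `A_{m,k} = Λ/(T^m + p, p^k)`: `Hom_{A_{m,k}}(N, A_{m,k}) ≅ Hom_ℤ(N, ℤ/p^k)` along the
# tail form, for every `A_{m,k}`-module `N`; perfectness of `A_{m,k}`-bilinear forms in Pontryagin currency

Topic `NumberTheory/EllipticCurves` (sequel to `IwasawaAlgebraEisensteinQuotientDuality`; pure commutative algebra;
definitions with bodies + theorems; no named fact, no instance, no notation, no `sorry`).

Howard 2004, §2.1: the functional `𝒟_𝔭 → ℚ_p/ℤ_p` "whose kernel contains no `S_𝔭`-submodules … induces an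
isomorphism of `S_𝔭`-modules `Hom_{S_𝔭}(N, 𝒟_𝔭(1)) ≅ Hom_{ℤ_p}(N, μ_{p^∞})` for any finitely or co-finitely
generated `S_𝔭`-module `N`". At the Eisenstein prime `𝔮 = (T^m + p)` and at the finite level `p^k` this is, for the
tail form `λ_k = EisensteinCoeff.tailFormZMod p hm k : A_{m,k} → ℤ/p^k` (perfect: `tailPairingZMod_bijective`):

* §1 **`EisensteinCoeff.tailFormZModComp : (N →ₗ[A_{m,k}] A_{m,k}) →+ (N →+ ZMod (p^k))`, `φ ↦ λ_k ∘ φ`, is a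
  bijection for EVERY `A_{m,k}`-module `N`** (`tailFormZModComp_bijective`, `EisensteinCoeff.homEquivZMod`): injective
  because the kernel of `λ_k` contains no non-zero ideal; surjective by the explicit `A_{m,k}`-linear lift
  `tailFormZModLift ψ n := (tailPairingZModEquiv)⁻¹ (a ↦ ψ(a • n))` (`tailFormZMod_tailFormZModLift_mul`).
  (The `S_m`/`ℤ_p`-level statement is the tree's `tailFormCompEquiv (specPowerBasis p hm)`.)
* §2 consequence for BILINEAR forms: for an `A_{m,k}`-bilinear `e : N →ₗ N →ₗ A_{m,k}`, `n ↦ e(n, ·)` is a bijection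
  `N → Hom_{A_{m,k}}(N, A_{m,k})` («perfect» in the `R`-valued sense of Howard's H.4 / the cell's `DualityDatum.perfect`)
  **iff** `n ↦ λ_k ∘ e(n, ·)` is a bijection `N → Hom_ℤ(N, ℤ/p^k)` («perfect» in Pontryagin/Cartier currency, where
  the tree's `tateDual` and `eisensteinTwistDualMap_bijective` live) — `bijective_iff_bijective_tailFormZModComp_comp`.

WHY (cell `pub/bsd-print-x9`, STUB 1c = H.4 of LEAD g3's skeleton v9 for the shared μ-item): the (W9)-A datum
(`Howard2004.DualityDatum`, lit g30 tranche 2) carries H.4 as an `R`-valued perfect pairing on the level module with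
`R = A_{m,k}`; the perfectness proved in the tree for the Eisenstein levels (`ZpExtensionEisensteinTwistDualPerfect`)
is in `Hom(·, μ_{p^k})`-currency; this file is the exact conversion. BSD is not proved by any of this.

References: [Howard2004HeegnerKolyvagin] B. Howard, Compositio Math. 140 (2004), §2.1 (the displayed isomorphism
`Hom_{S_𝔭}(N, 𝒟_𝔭(1)) ≅ Hom_{ℤ_p}(N, μ_{p^∞})`), §1.3 (H.4); [DeSmitRubinSchoof1997] Prop. 2.1 (Tate: `Hom_B(A, B)` free
of rank one over `A`).
-/

noncomputable section

open scoped Classical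

universe v

namespace Literature.NumberTheory.EllipticCurves.IwasawaAlgebra

variable (p : ℕ) [hp : Fact p.Prime] {m : ℕ} (hm : 1 ≤ m) (k : ℕ)
  {N : Type v} [AddCommGroup N] [Module (EisensteinCoeff p m k) N]

/-! ## §1 `Hom_{A_{m,k}}(N, A_{m,k}) ≅ Hom_ℤ(N, ℤ/p^k)` along the tail form -/

/-- **Post-composition with the tail form**: `Hom_{A_{m,k}}(N, A_{m,k}) → Hom(N, ℤ/p^k)`, `φ ↦ λ_k ∘ φ`.
[cite: Howard2004HeegnerKolyvagin, §2.1 (Hom_{S_𝔭}(N, 𝒟_𝔭(1)) ≅ Hom_{ℤ_p}(N, μ_{p^∞}))] -/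
def EisensteinCoeff.tailFormZModComp :
    (N →ₗ[EisensteinCoeff p m k] EisensteinCoeff p m k) →+ (N →+ ZMod (p ^ k)) where
  toFun φ := (EisensteinCoeff.tailFormZMod p hm k).toAddMonoidHom.comp φ.toAddMonoidHom
  map_zero' := by ext n; simp
  map_add' φ φ' := by ext n; simp

/-- Unfolding: `tailFormZModComp φ n = λ_k (φ n)`. [cite: Howard2004HeegnerKolyvagin, §2.1] -/
@[simp]
theorem EisensteinCoeff.tailFormZModComp_apply (φ : N →ₗ[EisensteinCoeff p m k] EisensteinCoeff p m k) (n : N) :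
    EisensteinCoeff.tailFormZModComp p hm k φ n = EisensteinCoeff.tailFormZMod p hm k (φ n) := rfl

/-- **`φ ↦ λ_k ∘ φ` is injective** — an `A_{m,k}`-linear functional is determined by its tail-form shadow, since the
kernel of `λ_k` contains no non-zero ideal (`eq_zero_of_forall_tailFormZMod_mul_eq_zero`).
[cite: Howard2004HeegnerKolyvagin, §2.1 («whose kernel contains no S_𝔭-submodules»)] -/
theorem EisensteinCoeff.tailFormZModComp_injective :
    Function.Injective (EisensteinCoeff.tailFormZModComp p hm k (N := N)) := by
  intro φ φ' h
  ext n
  rw [← sub_eq_zero]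
  refine EisensteinCoeff.eq_zero_of_forall_tailFormZMod_mul_eq_zero p hm k fun c => ?_
  have h1 : EisensteinCoeff.tailFormZMod p hm k (φ (c • n)) = EisensteinCoeff.tailFormZMod p hm k (φ' (c • n)) := by
    rw [← EisensteinCoeff.tailFormZModComp_apply, ← EisensteinCoeff.tailFormZModComp_apply, h]
  rw [sub_mul, map_sub, sub_eq_zero, mul_comm, mul_comm (φ' n), ← smul_eq_mul, ← smul_eq_mul, ← map_smul,
    ← map_smul]
  exact h1

/-- The additive character `a ↦ ψ(a • n)` of `A_{m,k}` (orbit map of `n` followed by `ψ`).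
[cite: Howard2004HeegnerKolyvagin, §2.1] -/
def EisensteinCoeff.orbitChar (ψ : N →+ ZMod (p ^ k)) (n : N) : EisensteinCoeff p m k →+ ZMod (p ^ k) :=
  ψ.comp (LinearMap.toSpanSingleton (EisensteinCoeff p m k) N n).toAddMonoidHom

/-- Unfolding: `orbitChar ψ n a = ψ (a • n)`. [cite: Howard2004HeegnerKolyvagin, §2.1] -/
@[simp]
theorem EisensteinCoeff.orbitChar_apply (ψ : N →+ ZMod (p ^ k)) (n : N) (a : EisensteinCoeff p m k) :
    EisensteinCoeff.orbitChar p k ψ n a = ψ (a • n) := rfl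

/-- **The `A_{m,k}`-linear lift of an additive character**: `tailFormZModLift ψ n` is the unique `y ∈ A_{m,k}` with
`λ_k(y a) = ψ(a • n)` for all `a` (inverse of the Pontryagin self-duality `tailPairingZModEquiv`).
[cite: Howard2004HeegnerKolyvagin, §2.1 (Hom_{S_𝔭}(N, 𝒟_𝔭(1)) ≅ Hom_{ℤ_p}(N, μ_{p^∞}))] -/
def EisensteinCoeff.tailFormZModLift (ψ : N →+ ZMod (p ^ k)) : N →ₗ[EisensteinCoeff p m k] EisensteinCoeff p m k where
  toFun n := (EisensteinCoeff.tailPairingZModEquiv p hm k).symm (EisensteinCoeff.orbitChar p k ψ n)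
  map_add' n n' := by
    rw [← map_add]; congr 1; ext a
    rw [AddMonoidHom.add_apply, EisensteinCoeff.orbitChar_apply, EisensteinCoeff.orbitChar_apply,
      EisensteinCoeff.orbitChar_apply, smul_add, map_add]
  map_smul' c n := by
    apply (EisensteinCoeff.tailPairingZModEquiv p hm k).injective
    rw [AddEquiv.apply_symm_apply, RingHom.id_apply, smul_eq_mul]
    ext a
    rw [EisensteinCoeff.tailPairingZModEquiv_apply, EisensteinCoeff.tailPairingZMod_mul_left,
      ← EisensteinCoeff.tailPairingZModEquiv_apply, AddEquiv.apply_symm_apply, EisensteinCoeff.orbitChar_apply,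
      EisensteinCoeff.orbitChar_apply, mul_smul, smul_comm a c n]

/-- Defining property: `λ_k(tailFormZModLift ψ n · a) = ψ(a • n)`. [cite: Howard2004HeegnerKolyvagin, §2.1] -/
theorem EisensteinCoeff.tailFormZMod_tailFormZModLift_mul (ψ : N →+ ZMod (p ^ k)) (n : N) (a : EisensteinCoeff p m k) :
    EisensteinCoeff.tailFormZMod p hm k (EisensteinCoeff.tailFormZModLift p hm k ψ n * a) = ψ (a • n) := by
  rw [← EisensteinCoeff.tailPairingZMod_apply_apply, ← EisensteinCoeff.tailPairingZModEquiv_apply]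
  change EisensteinCoeff.tailPairingZModEquiv p hm k
    ((EisensteinCoeff.tailPairingZModEquiv p hm k).symm (EisensteinCoeff.orbitChar p k ψ n)) a = _
  rw [AddEquiv.apply_symm_apply, EisensteinCoeff.orbitChar_apply]

/-- `λ_k ∘ (tailFormZModLift ψ) = ψ`. [cite: Howard2004HeegnerKolyvagin, §2.1] -/
theorem EisensteinCoeff.tailFormZModComp_tailFormZModLift (ψ : N →+ ZMod (p ^ k)) :
    EisensteinCoeff.tailFormZModComp p hm k (EisensteinCoeff.tailFormZModLift p hm k ψ) = ψ := by
  ext n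
  rw [EisensteinCoeff.tailFormZModComp_apply, ← mul_one (EisensteinCoeff.tailFormZModLift p hm k ψ n),
    EisensteinCoeff.tailFormZMod_tailFormZModLift_mul, one_smul]

/-- **Frobenius reciprocity for `A_{m,k}`**: for every `A_{m,k}`-module `N`, `φ ↦ λ_k ∘ φ` is a bijection
`Hom_{A_{m,k}}(N, A_{m,k}) → Hom_ℤ(N, ℤ/p^k)` — the finite-level form of Howard's
`Hom_{S_𝔭}(N, 𝒟_𝔭(1)) ≅ Hom_{ℤ_p}(N, μ_{p^∞})`. [cite: Howard2004HeegnerKolyvagin, §2.1 (the displayed isomorphism)] -/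
theorem EisensteinCoeff.tailFormZModComp_bijective :
    Function.Bijective (EisensteinCoeff.tailFormZModComp p hm k (N := N)) :=
  ⟨EisensteinCoeff.tailFormZModComp_injective p hm k,
    fun ψ => ⟨EisensteinCoeff.tailFormZModLift p hm k ψ, EisensteinCoeff.tailFormZModComp_tailFormZModLift p hm k ψ⟩⟩

/-- **`Hom_{A_{m,k}}(N, A_{m,k}) ≃+ Hom_ℤ(N, ℤ/p^k)`, `φ ↦ λ_k ∘ φ`.** [cite: Howard2004HeegnerKolyvagin, §2.1 (the displayed isomorphism)] -/
def EisensteinCoeff.homEquivZMod : (N →ₗ[EisensteinCoeff p m k] EisensteinCoeff p m k) ≃+ (N →+ ZMod (p ^ k)) :=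
  AddEquiv.ofBijective (EisensteinCoeff.tailFormZModComp p hm k) (EisensteinCoeff.tailFormZModComp_bijective p hm k)

/-- Unfolding: `homEquivZMod φ n = λ_k (φ n)`. [cite: Howard2004HeegnerKolyvagin, §2.1] -/
@[simp]
theorem EisensteinCoeff.homEquivZMod_apply (φ : N →ₗ[EisensteinCoeff p m k] EisensteinCoeff p m k) (n : N) :
    EisensteinCoeff.homEquivZMod p hm k φ n = EisensteinCoeff.tailFormZMod p hm k (φ n) := rfl

/-- The inverse of the reciprocity bijection is the lift. [cite: Howard2004HeegnerKolyvagin, §2.1] -/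
theorem EisensteinCoeff.homEquivZMod_symm_apply (ψ : N →+ ZMod (p ^ k)) :
    (EisensteinCoeff.homEquivZMod p hm k).symm ψ = EisensteinCoeff.tailFormZModLift p hm k ψ :=
  (EisensteinCoeff.homEquivZMod p hm k).injective (by
    rw [AddEquiv.apply_symm_apply]; exact (EisensteinCoeff.tailFormZModComp_tailFormZModLift p hm k ψ).symm)

/-! ## §2 Perfectness of `A_{m,k}`-bilinear forms: `R`-valued versus Pontryagin currency -/

/-- **An `A_{m,k}`-bilinear form `e : N × N' → A_{m,k}` is perfect (`n ↦ e(n, ·)` bijective onto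
`Hom_{A_{m,k}}(N', A_{m,k})`) iff `n ↦ λ_k ∘ e(n, ·)` is bijective onto `Hom_ℤ(N', ℤ/p^k)`** — Howard's `R`-valued
perfectness (H.4, «perfect R-bilinear pairing T × T → R(1)») versus Cartier/Pontryagin perfectness.
[cite: Howard2004HeegnerKolyvagin, §1.3 (H.4) and §2.1 (the displayed isomorphism)] -/
theorem EisensteinCoeff.bijective_iff_bijective_tailFormZModComp_comp {N' : Type v} [AddCommGroup N']
    [Module (EisensteinCoeff p m k) N'] (e : N →ₗ[EisensteinCoeff p m k] N' →ₗ[EisensteinCoeff p m k] EisensteinCoeff p m k) :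
    Function.Bijective e ↔
      Function.Bijective (fun n => EisensteinCoeff.tailFormZModComp p hm k (e n) : N → (N' →+ ZMod (p ^ k))) := by
  change Function.Bijective e ↔ Function.Bijective (EisensteinCoeff.tailFormZModComp p hm k ∘ e)
  exact ((EisensteinCoeff.tailFormZModComp_bijective p hm k (N := N')).of_comp_iff' e).symm

/-- The Pontryagin form of a perfect `A_{m,k}`-bilinear form: `(n, n') ↦ λ_k(e n n')` has `n ↦ λ_k ∘ e(n, ·)` bijective.
[cite: Howard2004HeegnerKolyvagin, §1.3 (H.4) and §2.1] -/
theorem EisensteinCoeff.bijective_tailFormZModComp_comp_of_bijective {N' : Type v} [AddCommGroup N']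
    [Module (EisensteinCoeff p m k) N'] {e : N →ₗ[EisensteinCoeff p m k] N' →ₗ[EisensteinCoeff p m k] EisensteinCoeff p m k}
    (he : Function.Bijective e) :
    Function.Bijective (fun n => EisensteinCoeff.tailFormZModComp p hm k (e n) : N → (N' →+ ZMod (p ^ k))) :=
  (EisensteinCoeff.bijective_iff_bijective_tailFormZModComp_comp p hm k e).mp he

end Literature.NumberTheory.EllipticCurves.IwasawaAlgebra
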